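import Literature.Probability.LatticeModels.ChessboardEstimateEvenTorus
import Literature.MathematicalPhysics.QuantumFieldTheory.ConstructiveQFTWave0Proofs
import Literature.MathematicalPhysics.QuantumFieldTheory.LatticeGaugeProofs
import HarnessLib

/-!
# Chessboard estimate for the `01`-plaquette field on every EVEN torus, from reflection
# Cauchy–Schwarz

Crux `FemtoCurvatureTwoPoint` (stmt-QuantumFields-9363), line `generic-step-gamma-encoding`,
reshape 2 of the upper-bound stub DU₂: the registered stub `stub_plaquetteProductRPCS` (RPCS:
`ψ(S)² ≤ ψ(symP i k S) · ψ(symM i k S)` for `ψ(S) = E[∏_{x∈S} f(P_{(x;01)})]`, `f ≥ 0` bounded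
measurable, every even torus, all four directions) implies the chessboard estimate

  `E f(P_0) ≤ (E ∏_x f(P_{(x;01)}))^{1/L⁴}`   on EVERY even torus `(ℤ/L)⁴`

(Fröhlich–Israel–Lieb–Simon 1978, Thm. 2.2), by the abstract even-side chessboard estimate
`Literature.Probability.LatticeModels.chessboard_le_rpow_even` applied to `f + ε` (so that
`ψ(univ) ≥ εⁿ > 0`) and the limit `ε → 0⁺` (dominated convergence). This supersedes the dyadic
form (`stub_chessboard_of_RPCS`, `L = 2^(n+1)`) used in the registered composition.

## Main result

* `stub_chessboardEven_of_RPCS` (registered helper stub of the crux): RPCS ⇒ the chessboard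
  estimate for the `01`-plaquette field on every even torus.
-/

noncomputable section

open scoped BigOperators
open MeasureTheory Filter Topology Finset

namespace Summit.QuantumFields.YangMills.Theorems.FemtoCurvatureTwoPoint

open Literature.MathematicalPhysics.QuantumFieldTheory
open Literature.Barriers.CriticalPhenomena.NonGibbs (symP symM)
open Literature.Probability.LatticeModels (chessboard_le_rpow_even)

/-- **RPCS ⇒ chessboard on every even torus.** From the reflection Cauchy–Schwarz inequalities for
products of a non-negative bounded measurable function of the `01`-plaquette field (the registered
stub `stub_plaquetteProductRPCS`, taken here as a hypothesis), the one-cell chessboard estimate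
`E f(P_0) ≤ (E ∏_x f(P_x))^{1/L⁴}` on every EVEN torus: apply the abstract even-side chessboard
estimate to `f + ε` (`ψ_ε(univ) ≥ ε^{L⁴} > 0`, `ψ_ε(∅) = 1`) at the singleton `{0}` and let
`ε → 0⁺` (dominated convergence for `E ∏_x (f(P_x) + ε)`). -/
theorem stub_chessboardEven_of_RPCS :
    (∀ (G : Type) [Group G] [TopologicalSpace G] [IsTopologicalGroup G] [CompactSpace G]
          [MeasurableSpace G] [BorelSpace G] (N : ℕ) (ρ : G →* Matrix (Fin N) (Fin N) ℂ),
        Continuous ρ → (∀ g, ρ g ∈ Matrix.unitaryGroup (Fin N) ℂ) →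
        ∀ (L : ℕ) [NeZero L], Even L → ∀ (β : ℝ), 0 ≤ β →
        ∀ (f : ℝ → ℝ), Measurable f → (∀ t, 0 ≤ f t) → (∃ M : ℝ, ∀ t, f t ≤ M) →
        ∀ (ψ : Finset (Fin 4 → ZMod L) → ℝ),
          (ψ = fun S => wilsonExpectation (d := 4) (L := L) ρ β
            (fun U => ∏ x ∈ S, f ((N : ℝ) - (ρ (plaquetteHolonomy U x 0 1)).trace.re))) →
          ∀ (i : Fin 4) (k : ZMod L) (S : Finset (Fin 4 → ZMod L)),
            ψ S ^ 2 ≤ ψ (symP i k S) * ψ (symM i k S)) →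
    ∀ (G : Type) [Group G] [TopologicalSpace G] [IsTopologicalGroup G] [CompactSpace G]
        [MeasurableSpace G] [BorelSpace G] (N : ℕ) (ρ : G →* Matrix (Fin N) (Fin N) ℂ),
      Continuous ρ → (∀ g, ρ g ∈ Matrix.unitaryGroup (Fin N) ℂ) →
      ∀ (L : ℕ) [NeZero L], Even L → ∀ (β : ℝ), 0 ≤ β →
      ∀ (f : ℝ → ℝ), Measurable f → (∀ t, 0 ≤ f t) → (∃ M : ℝ, ∀ t, f t ≤ M) →
        wilsonExpectation (d := 4) (L := L) ρ β
            (fun U => f ((N : ℝ) - (ρ (plaquetteHolonomy U 0 0 1)).trace.re)) ≤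
          (wilsonExpectation (d := 4) (L := L) ρ β
            (fun U => ∏ x : Fin 4 → ZMod L, f ((N : ℝ) - (ρ (plaquetteHolonomy U x 0 1)).trace.re)))
            ^ ((1 : ℝ) / (L : ℝ) ^ 4) := by
  intro hR G _ _ _ _ _ _ N ρ hρ hu L _ hL β hβ f hf hf0 hfM
  obtain ⟨M, hM⟩ := hfM
  haveI := isProbabilityMeasure_wilsonMeasure (d := 4) (L := L) (G := G) ρ hρ β
  set μ : Measure (GaugeConfig 4 L G) := wilsonMeasure (d := 4) (L := L) ρ β with hμ
  -- the plaquette functions `Pf x U = f(P_x(U))`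
  set Pf : (Fin 4 → ZMod L) → GaugeConfig 4 L G → ℝ :=
    fun x U => f ((N : ℝ) - (ρ (plaquetteHolonomy U x 0 1)).trace.re) with hPf
  have hPf_meas : ∀ x, Measurable (Pf x) := fun x =>
    hf.comp (measurable_const.sub
      (WilsonRP.measurable_plaqRe (d := 4) (L := L) ρ hρ (x, ⟨((0 : Fin 4), (1 : Fin 4)), by decide⟩)))
  have hPf0 : ∀ x U, 0 ≤ Pf x U := fun x U => hf0 _
  have hPfM : ∀ x U, Pf x U ≤ M := fun x U => hM _
  have hM0 : 0 ≤ M := (hPf0 0 1).trans (hPfM 0 1)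
  -- the two sides
  set a : ℝ := ∫ U, Pf 0 U ∂μ with ha
  set b : ℝ := ∫ U, ∏ x, Pf x U ∂μ with hb
  set n : ℕ := L ^ 4 with hn
  have hnpos : 0 < n := pow_pos (Nat.pos_of_ne_zero (NeZero.ne L)) 4
  have hLn : ((L : ℝ) ^ 4) = (n : ℝ) := by rw [hn]; push_cast; ring
  change a ≤ b ^ ((1 : ℝ) / (L : ℝ) ^ 4)
  rw [hLn]
  have ha0 : 0 ≤ a := integral_nonneg fun U => hPf0 0 U
  have hb0 : 0 ≤ b := integral_nonneg fun U => Finset.prod_nonneg fun x _ => hPf0 x U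
  -- products with `ε`
  have hprod_meas : ∀ (ε : ℝ) (S : Finset (Fin 4 → ZMod L)),
      Measurable fun U => ∏ x ∈ S, (Pf x U + ε) := fun ε S =>
    Finset.measurable_prod _ fun x _ => (hPf_meas x).add measurable_const
  have hprod_bound : ∀ (ε : ℝ), 0 ≤ ε → ∀ (S : Finset (Fin 4 → ZMod L)) (U : GaugeConfig 4 L G),
      |∏ x ∈ S, (Pf x U + ε)| ≤ (M + ε) ^ S.card := by
    intro ε hε S U
    rw [abs_of_nonneg (Finset.prod_nonneg fun x _ => by linarith [hPf0 x U])]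
    calc ∏ x ∈ S, (Pf x U + ε) ≤ ∏ _x ∈ S, (M + ε) :=
          Finset.prod_le_prod (fun x _ => by linarith [hPf0 x U]) fun x _ => by linarith [hPfM x U]
      _ = (M + ε) ^ S.card := Finset.prod_const _
  have hprod_int : ∀ (ε : ℝ), 0 ≤ ε → ∀ (S : Finset (Fin 4 → ZMod L)),
      Integrable (fun U => ∏ x ∈ S, (Pf x U + ε)) μ := fun ε hε S =>
    Integrable.of_bound (C := (M + ε) ^ S.card) (hprod_meas ε S).aestronglyMeasurable
      (ae_of_all _ fun U => by rw [Real.norm_eq_abs]; exact hprod_bound ε hε S U)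
  -- the chessboard estimate for `f + ε`, `ε > 0`
  have hchess : ∀ ε : ℝ, 0 < ε →
      a + ε ≤ (∫ U, ∏ x, (Pf x U + ε) ∂μ) ^ ((1 : ℝ) / (n : ℝ)) := by
    intro ε hε
    set ψ : Finset (Fin 4 → ZMod L) → ℝ := fun S => ∫ U, ∏ x ∈ S, (Pf x U + ε) ∂μ with hψ
    -- RPCS for `f + ε`
    have hcs : ∀ (i : Fin 4) (k : ZMod L) (S : Finset (Fin 4 → ZMod L)),
        ψ S ^ 2 ≤ ψ (symP i k S) * ψ (symM i k S) :=
      hR G N ρ hρ hu L hL β hβ (fun t => f t + ε) (hf.add measurable_const)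
        (fun t => by linarith [hf0 t]) ⟨M + ε, fun t => by linarith [hM t]⟩ ψ rfl
    have h0 : ∀ S, 0 ≤ ψ S := fun S =>
      integral_nonneg fun U => Finset.prod_nonneg fun x _ => by linarith [hPf0 x U]
    have hempty : ψ ∅ ≤ 1 := by
      simp only [hψ, Finset.prod_empty, integral_const, probReal_univ, smul_eq_mul, one_mul, le_refl]
    have h1 : 0 < ψ univ := by
      have hεn : (0 : ℝ) < ε ^ (univ : Finset (Fin 4 → ZMod L)).card := pow_pos hε _
      refine lt_of_lt_of_le hεn ?_
      calc ε ^ (univ : Finset (Fin 4 → ZMod L)).card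
          = ∫ _U, ε ^ (univ : Finset (Fin 4 → ZMod L)).card ∂μ := by
            rw [integral_const, probReal_univ, one_smul]
        _ ≤ ψ univ := integral_mono (integrable_const _) (hprod_int ε hε.le univ) fun U => by
            beta_reduce
            rw [← Finset.prod_const]
            exact Finset.prod_le_prod (fun _ _ => hε.le) fun x _ => by linarith [hPf0 x U]
    have key := chessboard_le_rpow_even (d := 4) (N := L) hL h0 hempty h1 hcs {0}
    rw [Finset.card_singleton, Nat.cast_one] at key
    have hψ0 : ψ {0} = a + ε := by
      simp only [hψ, Finset.prod_singleton]
      rw [integral_add ((hprod_int 0 le_rfl {0}).congr (ae_of_all _ fun U => by simp))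
        (integrable_const ε), integral_const, probReal_univ, one_smul]
    have hψu : ψ univ = ∫ U, ∏ x, (Pf x U + ε) ∂μ := rfl
    have hnL : ((L : ℝ) ^ 4) = (n : ℝ) := hLn
    rw [hψ0, hψu, hnL] at key
    exact key
  -- the limit `ε → 0⁺` of the right-hand side (dominated convergence)
  have hlim : Tendsto (fun ε : ℝ => ∫ U, ∏ x, (Pf x U + ε) ∂μ) (𝓝[>] 0) (𝓝 b) := by
    have hb' : b = ∫ U, ∏ x, (Pf x U + 0) ∂μ := by simp [hb]
    rw [hb']
    refine tendsto_integral_filter_of_dominated_convergence (fun _ => (M + 1) ^ n) ?_ ?_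
      (integrable_const _) ?_
    · exact Eventually.of_forall fun ε => (hprod_meas ε univ).aestronglyMeasurable
    · have hε1 : ∀ᶠ ε : ℝ in 𝓝[>] 0, ε ∈ Set.Ioo (0 : ℝ) 1 :=
        Ioo_mem_nhdsGT one_pos
      filter_upwards [hε1] with ε hε
      refine ae_of_all _ fun U => ?_
      rw [Real.norm_eq_abs]
      refine (hprod_bound ε hε.1.le univ U).trans ?_
      rw [Finset.card_univ, show Fintype.card (Fin 4 → ZMod L) = n by
        rw [Fintype.card_fun, ZMod.card, Fintype.card_fin]]
      exact pow_le_pow_left₀ (by linarith [hM0, hε.1]) (by linarith [hε.2]) n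
    · refine ae_of_all _ fun U => ?_
      have hc : Continuous fun ε : ℝ => ∏ x, (Pf x U + ε) :=
        continuous_finsetProd _ fun x _ => continuous_const.add continuous_id
      exact (hc.tendsto 0).mono_left nhdsWithin_le_nhds
  -- conclude: `a ≤ b^{1/n}` by contradiction
  by_contra hlt
  rw [not_le] at hlt
  have hn0 : (0 : ℝ) < n := by exact_mod_cast hnpos
  have hninv : 0 < (1 : ℝ) / n := by positivity
  -- `b < a^n`
  have hban : b < a ^ (n : ℝ) := by
    have h1 : (b ^ ((1 : ℝ) / n)) ^ (n : ℝ) = b := by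
      rw [← Real.rpow_mul hb0, one_div, inv_mul_cancel₀ hn0.ne', Real.rpow_one]
    rw [← h1]
    exact Real.rpow_lt_rpow (Real.rpow_nonneg hb0 _) hlt hn0
  -- pick `ε > 0` with `∫ ∏ (Pf + ε) < a^n`
  have hev : ∀ᶠ ε : ℝ in 𝓝[>] 0, (∫ U, ∏ x, (Pf x U + ε) ∂μ) < a ^ (n : ℝ) :=
    hlim.eventually (gt_mem_nhds hban)
  obtain ⟨ε, hε, hεpos⟩ := (hev.and (eventually_mem_nhdsWithin)).exists
  have hεpos' : 0 < ε := hεpos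
  have h1 := hchess ε hεpos'
  have h2 : (∫ U, ∏ x, (Pf x U + ε) ∂μ) ^ ((1 : ℝ) / n) < (a ^ (n : ℝ)) ^ ((1 : ℝ) / n) :=
    Real.rpow_lt_rpow (integral_nonneg fun U => Finset.prod_nonneg fun x _ => by
      linarith [hPf0 x U]) hε hninv
  have h3 : (a ^ (n : ℝ)) ^ ((1 : ℝ) / n) = a := by
    rw [← Real.rpow_mul ha0, one_div, mul_inv_cancel₀ hn0.ne', Real.rpow_one]
  rw [h3] at h2
  linarith

end Summit.QuantumFields.YangMills.Theorems.FemtoCurvatureTwoPoint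

end
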